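import Summits.MatrixMultiplication.MatrixMultiplication.Theses.GelfandPairHosts

/-!
# `GelfandPairHosts.GelfandHosting` (stmt-MatrixMultiplication-7381), line `birth`,
# stub `stub_gelfandTrick`: Gelfand's trick for generously transitive actions

Route `MatrixMultiplication/GelfandPairHosts`, crux `GelfandHosting`
(stmt-MatrixMultiplication-7381), line `birth`, stub `stub_gelfandTrick`.

If a group `G` acts on a finite set `X` *generously transitively* — every pair of points is
swapped by some group element, `g • x = y` and `g • y = x` — then any two `G`-invariant complex
matrices on `X` commute, i.e. the centraliser algebra of the permutation module `ℂ[X]` is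
commutative (`X` is multiplicity-free).  This is the multiplicity-freeness certificate used by the
assembly `GelfandHosting_of` of the line `birth`.

Proof (Gelfand's trick, directly on matrices; `G` may be infinite and `X` empty).
* `gelfandTrick_symm_of_invariant`: invariance + swapping make an invariant matrix symmetric,
  `A y x = A (g • x) (g • y) = A x y`.
* `gelfandTrick_mul_invariant`: the product of two invariant matrices is invariant (reindex the
  inner sum along the permutation `z ↦ g • z`).
* Hence `A`, `B` and `A * B` are symmetric, and
  `(B A)(x, y) = Σ_z B x z · A z y = Σ_z A y z · B z x = (A B)(y, x) = (A B)(x, y)`.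

Only Mathlib is used (`Matrix.mul_apply`, `Fintype.sum_equiv`, `MulAction.toPerm`).
-/

-- single-conjunct summit: the mandated namespace repeats `MatrixMultiplication`
set_option linter.dupNamespace false

namespace Summit.MatrixMultiplication.MatrixMultiplication.Theorems

open scoped BigOperators

/-- Under a generously transitive action (every pair `x, y` is swapped by some `g`), a
`G`-invariant matrix is symmetric: `A y x = A (g • x) (g • y) = A x y`. [folklore] -/
theorem gelfandTrick_symm_of_invariant {G X R : Type*} [Group G] [MulAction G X]
    (hgt : ∀ x y : X, ∃ g : G, g • x = y ∧ g • y = x) (A : Matrix X X R)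
    (hA : ∀ (g : G) (x y : X), A (g • x) (g • y) = A x y) (x y : X) : A x y = A y x := by
  obtain ⟨g, hx, hy⟩ := hgt x y
  have h := hA g x y
  rw [hx, hy] at h
  exact h.symm

/-- The product of two `G`-invariant matrices on a finite `G`-set is `G`-invariant:
`(A B)(g • x, g • y) = Σ_z A (g • x) z · B z (g • y) = Σ_z A (g • x) (g • z) · B (g • z) (g • y)
 = Σ_z A x z · B z y`, reindexing along the permutation `z ↦ g • z`. [folklore] -/
theorem gelfandTrick_mul_invariant {G X R : Type*} [Group G] [MulAction G X] [Fintype X]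
    [NonUnitalNonAssocSemiring R] (A B : Matrix X X R)
    (hA : ∀ (g : G) (x y : X), A (g • x) (g • y) = A x y)
    (hB : ∀ (g : G) (x y : X), B (g • x) (g • y) = B x y) (g : G) (x y : X) :
    (A * B) (g • x) (g • y) = (A * B) x y := by
  rw [Matrix.mul_apply, Matrix.mul_apply]
  symm
  exact Fintype.sum_equiv (MulAction.toPerm g) _ _ fun z => by
    rw [MulAction.toPerm_apply, hA, hB]

/-- **Gelfand's trick.** If a group `G` acts generously transitively on a finite set `X` (for all
`x, y ∈ X` some `g ∈ G` swaps them: `g • x = y`, `g • y = x`), then any two `G`-invariant complex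
`X × X` matrices `A`, `B` commute, `A B = B A`; equivalently the centraliser algebra
`End_G(ℂ[X])` is commutative, i.e. the permutation module `ℂ[X]` is multiplicity-free.  Indeed
invariant matrices are symmetric, `A B` is again invariant hence symmetric, and
`(B A)(x, y) = Σ_z A y z · B z x = (A B)(y, x) = (A B)(x, y)` (cf. Macdonald, *Symmetric Functions
and Hall Polynomials*, 2nd ed., Ch. VII §1 (1.1)–(1.2); Ceccherini-Silberstein–Scarabotti–Tolli
2020, *Gelfand Triples*, Example 3.1). [folklore] -/
theorem stub_gelfandTrick :
    ∀ (G : Type) [Group G] (X : Type) [Fintype X] [MulAction G X],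
      (∀ x y : X, ∃ g : G, g • x = y ∧ g • y = x) →
      ∀ A B : Matrix X X ℂ, (∀ (g : G) (x y : X), A (g • x) (g • y) = A x y) →
        (∀ (g : G) (x y : X), B (g • x) (g • y) = B x y) → A * B = B * A := by
  intro G _ X _ _ hgt A B hA hB
  have hAs := gelfandTrick_symm_of_invariant hgt A hA
  have hBs := gelfandTrick_symm_of_invariant hgt B hB
  have hABs := gelfandTrick_symm_of_invariant hgt (A * B) (gelfandTrick_mul_invariant A B hA hB)
  ext x y
  rw [hABs x y, Matrix.mul_apply, Matrix.mul_apply]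
  refine Finset.sum_congr rfl fun z _ => ?_
  rw [hAs y z, hBs z x, mul_comm]

end Summit.MatrixMultiplication.MatrixMultiplication.Theorems
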